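import Literature.AlgebraicGeometry.HodgeTheory.ComplexTorusIntegralHodgeClassesKunnethProjectorsProduct
import Literature.AlgebraicGeometry.HodgeTheory.ComplexTorusIntegralHodgeClassesKunnethComponents
import Literature.AlgebraicGeometry.HodgeTheory.ComplexTorusIntegralHodgeClassesCorrespondenceExteriorProductComposition
import HarnessLib

/-!
# The Künneth bigrading of an exterior product of correspondences: `π_{n,X×X′} ∘ (α × β) = Σ_{s+t=n} (π_{s,X} ∘ α) × (π_{t,X′} ∘ β)`

Sequel of g29-#8 (`ComplexTorusIntegralHodgeClassesKunnethComponents`: `π_{s,X} ∘ α = K_s α`, `Σ_s π_{s,X} ∘ α = α` for `α ∈ Hdgᵃ(W × X, ℤ)` — Lange's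
Prop. 6.3.11 "`α ↦ π_i ∘ α` is a projection"), g29-#11 (`…KunnethProjectorsProduct`: `π_{n,X×X′} = Σ_{s+t=n} π_{s,X} × π_{t,X′}`) and g30-#2
(`…CorrespondenceExteriorProductComposition`: the interchange law `(α′ × β′) ∘ (α × β) = (α′ ∘ α) × (β′ ∘ β)`). For correspondences `α ∈ Hdgᵃ(W × X, ℤ)`,
`β ∈ Hdg^{a′}(W′ × X′, ℤ)` between complex tori, the Künneth decomposition (6.16) of the exterior product `α × β ∈ Hdg^{a+a′}((W × W′) × (X × X′), ℤ)` with
respect to the grading of the second factor `X × X′` is the product of the decompositions of `α` and `β` (the Künneth decomposition is compatible with exterior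
products; Fulton Example 16.1.12 "`(X, p) ⊗ (Y, q) = (X × Y, p × q)`"):

* §1 **`integralHodgeClassesCorrComp_corrCross_kunnethProjector_prod`** — **`π_{n,X×X′} ∘ (α × β) = Σ_{s ≤ 2g_X} Σ_{t ≤ 2g_{X′}} δ_{n,s+t} · (π_{s,X} ∘ α) × (π_{t,X′} ∘ β)`**:
  the component of `α × β` of Künneth type `n` (Prop. 6.3.11 for `X × X′`) is the sum of the exterior products of the components of `α` of type `s` and of `β` of
  type `t` with `s + t = n` (g29-#11, the interchange law g30-#2, and bi-additivity of Fulton's composition);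
* §2 **`sum_sum_corrCross_integralHodgeClassesCorrComp_kunnethProjector`** — **`Σ_{s ≤ 2g_X} Σ_{t ≤ 2g_{X′}} (π_{s,X} ∘ α) × (π_{t,X′} ∘ β) = α × β`** (`Σ_s π_{s,X} ∘ α = α`,
  g29-#8, on both factors, and bi-additivity of `×`).

Everything is a theorem; no definition, no named fact (D-0026). Frames: `eX`, `eXX`, `eX′`, `eX′X′`, `eXX′`, `ePP` as in g29-#11; `eT`, `eWX` (composites on
`W × (X × X)`), `eT′`, `eW′X′`, and `eTP`, `eQ` (composite on `(W × W′) × ((X × X′) × (X × X′))`) arbitrary, with `hnP`, `hnQ` recording the ranks.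

## References
* [Lange2023AbelianVarietiesComplex] H. Lange, Abelian Varieties over the Complex Numbers, Springer 2023, §6.3.3 (6.15)–(6.16) and Prop. 6.3.8 (p0317 L6–L17),
  §6.3.4 Prop. 6.3.11 (p0319 L9–L21).
* [Fulton1998] W. Fulton, Intersection Theory, 2nd ed., Springer 1998, §16.1 Example 16.1.12 (p0300 L9–L12, p0301 L9), Def. 16.1.1 (p0293 L3–L7).
* [VoisinHodgeI2002] C. Voisin, Hodge Theory and Complex Algebraic Geometry I, CUP 2002, §11.3.3 Thm. 11.38.
-/

noncomputable section

open CategoryTheory Function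

namespace Literature.AlgebraicGeometry.HodgeTheory

open Literature.AlgebraicGeometry.Motives Literature.AlgebraicGeometry.Motives.HodgeStructure
open Literature.Geometry.Kaehler Literature.Geometry.Kaehler.ComplexTorus

namespace ComplexTorusCat

section Bigrading

variable {W W' : ComplexTorusCat} (X X' : ComplexTorusCat) {gX gX' gXX gX'X' G GP : ℕ} (hG : gX + gX' = G)
  (eX : Fin (2 * gX) ≃ X.toIsog.ι) (eXX : Fin (2 * gXX) ≃ (prodObj X X).toIsog.ι)
  (hX0 : 2 * gX + 2 * 0 = 2 * gX) (hgX : gX + gX = 2 * gX) (hcX : 2 * gX + 2 * gX = 2 * gXX) (hgXX : gXX + gXX = 2 * gXX)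
  (eX' : Fin (2 * gX') ≃ X'.toIsog.ι) (eX'X' : Fin (2 * gX'X') ≃ (prodObj X' X').toIsog.ι)
  (hX'0 : 2 * gX' + 2 * 0 = 2 * gX') (hgX' : gX' + gX' = 2 * gX') (hcX' : 2 * gX' + 2 * gX' = 2 * gX'X') (hgX'X' : gX'X' + gX'X' = 2 * gX'X')
  (eXX' : Fin (2 * G) ≃ (prodObj X X').toIsog.ι) (ePP : Fin (2 * GP) ≃ (prodObj (prodObj X X') (prodObj X X')).toIsog.ι)
  (hP0 : 2 * G + 2 * 0 = 2 * G) (hgP : G + G = 2 * G) (hcP : 2 * G + 2 * G = 2 * GP) (hgPP : GP + GP = 2 * GP)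
  -- frames and ranks for the composites `π_{s,X} ∘ α` on `W × (X × X)`, `π_{t,X′} ∘ β` on `W′ × (X′ × X′)`
  {nT nWX gT gWX nT' nW'X' gT' gW'X' a c l₃ a' c' l₃' : ℕ} (eT : Fin nT ≃ (prodObj W (prodObj X X)).toIsog.ι) (eWX : Fin nWX ≃ (prodObj W X).toIsog.ι)
  (hac : a + gX = c) (h3 : l₃ + 2 * c = nT) (hgT : gT + gT = nT) (h3' : l₃ + 2 * a = nWX) (hgWX : gWX + gWX = nWX)
  (eT' : Fin nT' ≃ (prodObj W' (prodObj X' X')).toIsog.ι) (eW'X' : Fin nW'X' ≃ (prodObj W' X').toIsog.ι)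
  (hac' : a' + gX' = c') (k3 : l₃' + 2 * c' = nT') (hgT' : gT' + gT' = nT') (k3' : l₃' + 2 * a' = nW'X') (hgW'X' : gW'X' + gW'X' = nW'X')
  -- frames and ranks for the composite `π_{n,X×X′} ∘ (α × β)` on `(W × W′) × ((X × X′) × (X × X′))`
  {nTP nQ gTP gQ A CC L : ℕ} (eTP : Fin nTP ≃ (prodObj (prodObj W W') (prodObj (prodObj X X') (prodObj X X'))).toIsog.ι)
  (eQ : Fin nQ ≃ (prodObj (prodObj W W') (prodObj X X')).toIsog.ι) (hnP : nTP = nT + nT') (hnQ : nQ = nWX + nW'X') (hAA : a + a' = A) (hAG : A + G = CC)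
  (H3 : L + 2 * CC = nTP) (hgTP : gTP + gTP = nTP) (H3' : L + 2 * A = nQ) (hgQ : gQ + gQ = nQ)

/-! ### §1 `π_{n,X×X′} ∘ (α × β) = Σ_{s+t=n} (π_{s,X} ∘ α) × (π_{t,X′} ∘ β)` -/

set_option maxHeartbeats 800000 in
include hnP hnQ hG in
/-- **`π_{n,X×X′} ∘ (α × β) = Σ_{s ≤ 2g_X} Σ_{t ≤ 2g_{X′}} δ_{n,s+t} · (π_{s,X} ∘ α) × (π_{t,X′} ∘ β)`** for correspondences `α ∈ Hdgᵃ(W × X, ℤ)`, `β ∈ Hdg^{a′}(W′ × X′,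
ℤ)` of complex tori: the component of Künneth type `n` (for the grading of `X × X′`) of the exterior product `α × β = q^*α · q′^*β` is the sum of the exterior
products of the type-`s` component of `α` and the type-`t` component of `β` over `s + t = n` — "`α ↦ π_i ∘ α` is a projection onto `Ch^p(X × X)^{2p−i}`" (Prop.
6.3.11), here for `X × X′` with `π_{n,X×X′} = Σ_{s+t=n} π_{s,X} × π_{t,X′}` (g29-#11) and the interchange law `(π_{s,X} × π_{t,X′}) ∘ (α × β) = (π_{s,X} ∘ α) ×
(π_{t,X′} ∘ β)` (g30-#2). [cite: Lange2023AbelianVarietiesComplex, §6.3.4 Prop. 6.3.11 (p0319 L9–L21) and §6.3.3 (6.16) (p0317 L10–L14)]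
[cite: Fulton1998, §16.1 Example 16.1.12 (p0300 L9–L12, p0301 L9)] [cite: VoisinHodgeI2002, §11.3.3 Thm. 11.38] -/
theorem integralHodgeClassesCorrComp_corrCross_kunnethProjector_prod (α : integralHodgeClasses (prodObj W X).toIsog.Φ a)
    (β : integralHodgeClasses (prodObj W' X').toIsog.Φ a') (n : ℕ) :
    integralHodgeClassesPushforward CC A
        (liftHom (fstHom (prodObj W W') (prodObj (prodObj X X') (prodObj X X')))
          (sndHom (prodObj W W') (prodObj (prodObj X X') (prodObj X X')) ≫ sndHom (prodObj X X') (prodObj X X'))) eTP eQ H3 hgTP H3' hgQ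
        (integralHodgeClassesCup (prodObj (prodObj W W') (prodObj (prodObj X X') (prodObj X X'))).toIsog.Φ hAG
          (integralHodgeClassesPullbackHom
            (liftHom (fstHom (prodObj W W') (prodObj (prodObj X X') (prodObj X X')))
              (sndHom (prodObj W W') (prodObj (prodObj X X') (prodObj X X')) ≫ fstHom (prodObj X X') (prodObj X X'))) A
            (integralHodgeClassesCup (prodObj (prodObj W W') (prodObj X X')).toIsog.Φ hAA
              (integralHodgeClassesPullbackHom
                (liftHom (fstHom (prodObj W W') (prodObj X X') ≫ fstHom W W') (sndHom (prodObj W W') (prodObj X X') ≫ fstHom X X')) a α)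
              (integralHodgeClassesPullbackHom
                (liftHom (fstHom (prodObj W W') (prodObj X X') ≫ sndHom W W') (sndHom (prodObj W W') (prodObj X X') ≫ sndHom X X')) a' β)))
          (integralHodgeClassesPullbackHom (sndHom (prodObj W W') (prodObj (prodObj X X') (prodObj X X'))) G
            (kunnethProjector (prodObj X X') eXX' ePP hP0 hgP hcP hgPP n))) =
      ∑ s ∈ Finset.range (2 * gX + 1), ∑ t ∈ Finset.range (2 * gX' + 1),
        if n = s + t then
          integralHodgeClassesCup (prodObj (prodObj W W') (prodObj X X')).toIsog.Φ hAA
            (integralHodgeClassesPullbackHom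
              (liftHom (fstHom (prodObj W W') (prodObj X X') ≫ fstHom W W') (sndHom (prodObj W W') (prodObj X X') ≫ fstHom X X')) a
              (integralHodgeClassesPushforward c a (liftHom (fstHom W (prodObj X X)) (sndHom W (prodObj X X) ≫ sndHom X X)) eT eWX h3 hgT h3' hgWX
                (integralHodgeClassesCup (prodObj W (prodObj X X)).toIsog.Φ hac
                  (integralHodgeClassesPullbackHom (liftHom (fstHom W (prodObj X X)) (sndHom W (prodObj X X) ≫ fstHom X X)) a α)
                  (integralHodgeClassesPullbackHom (sndHom W (prodObj X X)) gX (kunnethProjector X eX eXX hX0 hgX hcX hgXX s)))))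
            (integralHodgeClassesPullbackHom
              (liftHom (fstHom (prodObj W W') (prodObj X X') ≫ sndHom W W') (sndHom (prodObj W W') (prodObj X X') ≫ sndHom X X')) a'
              (integralHodgeClassesPushforward c' a' (liftHom (fstHom W' (prodObj X' X')) (sndHom W' (prodObj X' X') ≫ sndHom X' X')) eT' eW'X' k3 hgT' k3' hgW'X'
                (integralHodgeClassesCup (prodObj W' (prodObj X' X')).toIsog.Φ hac'
                  (integralHodgeClassesPullbackHom (liftHom (fstHom W' (prodObj X' X')) (sndHom W' (prodObj X' X') ≫ fstHom X' X')) a' β)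
                  (integralHodgeClassesPullbackHom (sndHom W' (prodObj X' X')) gX' (kunnethProjector X' eX' eX'X' hX'0 hgX' hcX' hgX'X' t)))))
        else 0 := by
  rw [kunnethProjector_prod X X' hG eX eXX hX0 hgX hcX hgXX eX' eX'X' hX'0 hgX' hcX' hgX'X' eXX' ePP hP0 hgP hcP hgPP n]
  simp only [map_sum]
  refine Finset.sum_congr rfl fun s _ ↦ Finset.sum_congr rfl fun t _ ↦ ?_
  split_ifs
  · exact integralHodgeClassesCorrComp_corrCross_corrCross eT eWX eT' eW'X' eTP eQ hnP hnQ hgT hgWX hgT' hgW'X' hgTP hgQ hac hac' hAA hG hAG hAA h3 h3' k3 k3'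
      H3 H3' α β _ _
  · rw [map_zero, map_zero, map_zero]

/-! ### §2 `Σ_s Σ_t (π_{s,X} ∘ α) × (π_{t,X′} ∘ β) = α × β` -/

/-- **`Σ_{s ≤ 2a} Σ_{t ≤ 2a′} (π_{s,X} ∘ α) × (π_{t,X′} ∘ β) = α × β`**: the Künneth decomposition of an exterior product of correspondences (`Σ_s π_{s,X} ∘ α = α`, g29-#8
`sum_range_integralHodgeClassesCorrComp_kunnethProjector`, on both factors; bi-additivity of `α × β = q^*α · q′^*β`).
[cite: Lange2023AbelianVarietiesComplex, §6.3.4 Prop. 6.3.11 (proof, p0319 L17–L19)] [cite: Fulton1998, §16.1 Example 16.1.12 (p0301 L9)] -/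
theorem sum_sum_corrCross_integralHodgeClassesCorrComp_kunnethProjector (α : integralHodgeClasses (prodObj W X).toIsog.Φ a)
    (β : integralHodgeClasses (prodObj W' X').toIsog.Φ a') :
    ∑ s ∈ Finset.range (2 * a + 1), ∑ t ∈ Finset.range (2 * a' + 1),
        integralHodgeClassesCup (prodObj (prodObj W W') (prodObj X X')).toIsog.Φ hAA
          (integralHodgeClassesPullbackHom
            (liftHom (fstHom (prodObj W W') (prodObj X X') ≫ fstHom W W') (sndHom (prodObj W W') (prodObj X X') ≫ fstHom X X')) a
            (integralHodgeClassesPushforward c a (liftHom (fstHom W (prodObj X X)) (sndHom W (prodObj X X) ≫ sndHom X X)) eT eWX h3 hgT h3' hgWX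
              (integralHodgeClassesCup (prodObj W (prodObj X X)).toIsog.Φ hac
                (integralHodgeClassesPullbackHom (liftHom (fstHom W (prodObj X X)) (sndHom W (prodObj X X) ≫ fstHom X X)) a α)
                (integralHodgeClassesPullbackHom (sndHom W (prodObj X X)) gX (kunnethProjector X eX eXX hX0 hgX hcX hgXX s)))))
          (integralHodgeClassesPullbackHom
            (liftHom (fstHom (prodObj W W') (prodObj X X') ≫ sndHom W W') (sndHom (prodObj W W') (prodObj X X') ≫ sndHom X X')) a'
            (integralHodgeClassesPushforward c' a' (liftHom (fstHom W' (prodObj X' X')) (sndHom W' (prodObj X' X') ≫ sndHom X' X')) eT' eW'X' k3 hgT' k3' hgW'X'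
              (integralHodgeClassesCup (prodObj W' (prodObj X' X')).toIsog.Φ hac'
                (integralHodgeClassesPullbackHom (liftHom (fstHom W' (prodObj X' X')) (sndHom W' (prodObj X' X') ≫ fstHom X' X')) a' β)
                (integralHodgeClassesPullbackHom (sndHom W' (prodObj X' X')) gX' (kunnethProjector X' eX' eX'X' hX'0 hgX' hcX' hgX'X' t))))) =
      integralHodgeClassesCup (prodObj (prodObj W W') (prodObj X X')).toIsog.Φ hAA
        (integralHodgeClassesPullbackHom
          (liftHom (fstHom (prodObj W W') (prodObj X X') ≫ fstHom W W') (sndHom (prodObj W W') (prodObj X X') ≫ fstHom X X')) a α)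
        (integralHodgeClassesPullbackHom
          (liftHom (fstHom (prodObj W W') (prodObj X X') ≫ sndHom W W') (sndHom (prodObj W W') (prodObj X X') ≫ sndHom X X')) a' β) := by
  conv_rhs => rw [← sum_range_integralHodgeClassesCorrComp_kunnethProjector eX eXX hX0 hgX hcX hgXX eT eWX hac h3 hgT h3' hgWX α,
    ← sum_range_integralHodgeClassesCorrComp_kunnethProjector eX' eX'X' hX'0 hgX' hcX' hgX'X' eT' eW'X' hac' k3 hgT' k3' hgW'X' β]
  simp only [map_sum, AddMonoidHom.finsetSum_apply]
  exact Finset.sum_comm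

end Bigrading

end ComplexTorusCat

end Literature.AlgebraicGeometry.HodgeTheory
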